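import Literature.Computability.AlgebraicComplexity.KronRectOfLatinRectangles
import HarnessLib

/-!
# The generic degree monoid of an odd tensor format is co-finite (theorem-only)

Bürgisser–Ikenmeyer 2017 §5 [BurgisserIkenmeyer2017]: `E(m) = {d : ⊗³ℂ^m has a nonzero
SL_m³-invariant of degree d vanishing nowhere on generic tensors} = {mδ : k_m(δ) > 0} ∪ {0}`
(`genericTensorDegreeMonoid`, `genericTensorDegreeMonoid_eq_kronRect`), with Ex. 5.6 recording
`E(m) = {0} ∪ (e(m) + mℕ)` for `m ≤ 12` (Derksen's computations). This short file draws the structural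
consequence of the bridge `LRC(n, δ) ⇒ k_n(δ) > 0` (`KronRectOfLatinRectangles.lean`, from BILPS 2019
Thm. 27 / Kumar 2015 / Amanov–Yeliussizov 2022 Cor. 8.7) and of the tree's `LRC(α, β)` for every even
`β ≥ 2α²` (`BILPS2019.latinRectangleCondition_of_two_mul_sq_le`):

* `kronRect_pos_of_odd_of_le` — **for odd `m`, `k_m(δ) > 0` for EVERY `δ ≥ 2m² + m`**: an even
  `δ ≥ 2m²` is `kronRect_pos_of_two_mul_sq_le`; an odd `δ` is `(δ − m) + m` with `δ − m` even `≥ 2m²`,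
  and the square positivity `k_m(m) > 0` (Bessenrodt–Behns, `kronRect_self_pos`) feeds the semigroup
  property `kronRect_add_pos`;
* `mem_genericTensorDegreeMonoid_of_odd_of_le` — **`E(m)` is co-finite in `mℕ` for odd `m`**, with
  the explicit conductor bound `m(2m² + m)`;
* `mem_genericTensorDegreeMonoid_of_even_quotient` — for every `m ≥ 1`, every `d = mδ` with `δ` even
  `≥ 2m²` lies in `E(m)`.

The route (block additivity of signed Latin-rectangle counts + Drisko/Glynn + Bertrand, then the
incidence-design certificate) is the tree's, not printed in this form; BI 2017 proves `E(m) ≠ {0}`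
(`m² ∈ E(m)`, Thm. 5.9) and the structure `E(w) = m·a(w)·E'(w)` (Lemma 5.1), and lists `E(m)` for
`m ≤ 12`. Honest framing (cell `val-lit`): bookkeeping on invariant degrees of generic tensors; the
even-`m` odd-`δ` degrees (e.g. the atoms `k_12(5)`, `k_12(7)` of `BI2017_ex_5_6`) are not reached;
VP ≠ VNP is NOT proved and nothing here bears on it. No definitions, no named facts.

## References

* [BurgisserIkenmeyer2017] P. Bürgisser, C. Ikenmeyer, J. Algebra 477 (2017), §5: eq. (5.2),
  Lemma 5.1, Thm. 5.9, Ex. 5.6, Rem. 5.18, Problem 5.19.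
* [BlaserIkenmeyerLysikovPandeySchreyer2019] arXiv:1911.02534, §7.3 (Conj. 26 = `LRC`, Thm. 27).
* [AmanovYeliussizov2022] arXiv:2202.11059, Cor. 8.7, Rem. 8.8–8.9.
-/

noncomputable section

namespace Literature.Computability.AlgebraicComplexity

variable {m δ : ℕ}

/-- **For odd `m`, `k_m(δ) > 0` for EVERY `δ ≥ 2m² + m`**: an even `δ ≥ 2m²` is
`kronRect_pos_of_two_mul_sq_le`; an odd `δ` is `(δ − m) + m` with `δ − m` even `≥ 2m²`, and
`k_m(m) > 0` (`kronRect_self_pos`) feeds the semigroup property `kronRect_add_pos`.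
[cite: BurgisserIkenmeyer2017, §5 eq. (5.2) and Rem. 5.18]
[cite: BlaserIkenmeyerLysikovPandeySchreyer2019, §7.3 (Conj. 26)] -/
theorem kronRect_pos_of_odd_of_le (hm : Odd m) (h : 2 * m ^ 2 + m ≤ δ) : 0 < kronRect ℂ m δ := by
  have hm0 : 0 < m := hm.pos
  rcases Nat.even_or_odd δ with he | ho
  · exact kronRect_pos_of_two_mul_sq_le ℂ (by omega) he
  · have he : Even (δ - m) := Nat.Odd.sub_odd ho hm
    have h1 : 0 < kronRect ℂ m (δ - m) := kronRect_pos_of_two_mul_sq_le ℂ (by omega) he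
    have h3 := kronRect_add_pos hm0 h1 (kronRect_self_pos m hm0)
    rwa [Nat.sub_add_cancel (by omega : m ≤ δ)] at h3

/-- **The generic degree monoid of an odd format is co-finite in `mℕ`**: for odd `m`, every multiple
`d` of `m` with `d ≥ m(2m² + m)` lies in `E(m)` (an explicit conductor bound; BI 2017 Ex. 5.6 records
`E(m) = {0} ∪ (e(m) + mℕ)` for `m ≤ 12`). [cite: BurgisserIkenmeyer2017, §5 eq. (5.2) and Ex. 5.6] -/
theorem mem_genericTensorDegreeMonoid_of_odd_of_le (hm : Odd m) {d : ℕ} (hd : m ∣ d)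
    (h : m * (2 * m ^ 2 + m) ≤ d) : d ∈ genericTensorDegreeMonoid (Fin m) ℂ := by
  obtain ⟨δ, rfl⟩ := hd
  rw [genericTensorDegreeMonoid_eq_kronRect m]
  exact ⟨δ, rfl, kronRect_pos_of_odd_of_le hm (Nat.le_of_mul_le_mul_left h hm.pos)⟩

/-- **Every odd format has all large degrees, window form**: for odd `m` and `δ ≥ 2m² + m`,
`mδ ∈ E(m)`. [cite: BurgisserIkenmeyer2017, §5 eq. (5.2)] -/
theorem mul_mem_genericTensorDegreeMonoid_of_odd_of_le (hm : Odd m) (h : 2 * m ^ 2 + m ≤ δ) :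
    m * δ ∈ genericTensorDegreeMonoid (Fin m) ℂ :=
  mem_genericTensorDegreeMonoid_of_odd_of_le hm (dvd_mul_right m δ)
    (Nat.mul_le_mul_left m h)

/-- **Every format has all large EVEN degrees**: for `m ≥ 1`, every `d = mδ` with `δ` even `≥ 2m²`
lies in `E(m)` (the divisibility form of `mul_mem_genericTensorDegreeMonoid_of_two_mul_sq_le`).
[cite: BurgisserIkenmeyer2017, §5 eq. (5.2)] -/
theorem mem_genericTensorDegreeMonoid_of_even_quotient {d : ℕ} (hd : m ∣ d) (he : Even (d / m))
    (hm : 0 < m) (h : m * (2 * m ^ 2) ≤ d) : d ∈ genericTensorDegreeMonoid (Fin m) ℂ := by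
  obtain ⟨δ, rfl⟩ := hd
  rw [Nat.mul_div_cancel_left δ hm] at he
  exact mul_mem_genericTensorDegreeMonoid_of_two_mul_sq_le (Nat.le_of_mul_le_mul_left h hm) he

/-- Worked instances beyond BI's table: `E(13) ∋ 13·δ` for every `δ ≥ 351`, `E(15) ∋ 15·δ` for
every `δ ≥ 465` (`2m² + m`). [cite: BurgisserIkenmeyer2017, Ex. 5.6 and Problem 5.19] -/
theorem mul_mem_genericTensorDegreeMonoid_thirteen_fifteen (δ : ℕ) :
    (351 ≤ δ → 13 * δ ∈ genericTensorDegreeMonoid (Fin 13) ℂ) ∧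
      (465 ≤ δ → 15 * δ ∈ genericTensorDegreeMonoid (Fin 15) ℂ) :=
  ⟨fun h => mul_mem_genericTensorDegreeMonoid_of_odd_of_le (by decide) (by norm_num; omega),
    fun h => mul_mem_genericTensorDegreeMonoid_of_odd_of_le (by decide) (by norm_num; omega)⟩

end Literature.Computability.AlgebraicComplexity

end
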